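import Mathlib
import Literature.Topology.FourManifolds.ImmersionCriterion
import HarnessLib

/-!
# Non-separating spheres in `S¹ × Sⁿ` are standard up to diffeomorphism (Budney–Gabai 2019,
# Thm. 3.13)

Topic `Literature/Topology/FourManifolds` (named fact for the route
`SmoothPoincare4/CircularKirby`, item `NonSepSphereTransitive`; the case needed there is `n = 3`).

Source: R. Budney, D. Gabai, *Knotted 3-balls in `S⁴`*, arXiv:1912.09029 [BudneyGabai2019], §3,
p. 22 of v2 (read): **Theorem 3.13.** *"The group `Diff(S¹ × Sⁿ)` acts transitively on the
non-separating `n`-spheres in `S¹ × Sⁿ`. Moreover, every non-separating `n`-sphere is the fiber of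
a fiber bundle `S¹ × Sⁿ → S¹`."* (Proof, ibid.: "Provided `n < 3` this is classical. When `n ≥ 3`"
one isotopes a dual circle to `S¹ × {*}`, drills it out, and applies Theorem 3.12 — transitivity of
`Diff(S¹ × Bⁿ fix ∂)` on reducing balls, from the half-disc lemma and, alternatively, the
Cerf–Palais disc theorem.)

## Contents

* `standardSphere n : Sⁿ → S¹ × Sⁿ`, `p ↦ (1, p)` — the standard non-separating sphere
  `{1} × Sⁿ`; **proved**: `isSmoothEmbedding_standardSphere` (a smooth embedding, by the tree's
  immersion criterion `isSmoothEmbedding_of_injective_of_injective_mfderiv`),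
  `compl_range_standardSphere` (`= {1}ᶜ × Sⁿ`), `isConnected_compl_range_standardSphere`
  (non-separating for `n ≥ 1`).
* `BudneyGabai2019_thm_3_13` — the **named fact** (D-0014), first sentence of Thm. 3.13 as
  printed, for every `n`: any two smoothly embedded `n`-spheres in `S¹ × Sⁿ` with connected
  complements are carried onto one another (as subsets) by a self-diffeomorphism of `S¹ × Sⁿ`.
* Proved consequences (namespace `BudneyGabai2019_thm_3_13`): `exists_image_eq_range_standardSphere`
  (every non-separating `n`-sphere, `n ≥ 1`, is carried onto `{1} × Sⁿ`),
  `exists_image_eq_range_standardSphere_three` (the case `n = 3` in the exact shape of the route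
  item), and `exists_eq_preimage_fst` — the "moreover": every non-separating sphere is a fibre of
  the smooth fibre bundle `pr₁ ∘ Φ : S¹ × Sⁿ → S¹` (which is even trivial).

## Transcription notes

* "`n`-sphere in `S¹ × Sⁿ`" = the image of a smooth (`C^∞`) embedding
  `e : Sⁿ → S¹ × Sⁿ` (Mathlib `Manifold.IsSmoothEmbedding (𝓡 n) ((𝓡 1).prod (𝓡 n)) ∞ e`, `Sⁿ` the
  unit sphere of `EuclideanSpace ℝ (Fin (n + 1))`, `S¹` = Mathlib's `Circle`, both with their
  Mathlib manifold structures); "non-separating" = the complement of the image is connected;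
  "`Diff(S¹ × Sⁿ)` acts transitively" = for any two such spheres some diffeomorphism
  (`Diffeomorph`, all of `Diff`, no isotopy or orientation condition) maps one image onto the other.
* The standard-target form used by the route (`… = range (p ↦ (1, p))`) is the fact applied to
  `e₂ = standardSphere n`, whose hypotheses are discharged here (`n ≥ 1`; for `n = 0` there are no
  non-separating `0`-spheres in the disconnected `S¹ × S⁰`).
* The "moreover" clause is recorded as the proved corollary `exists_eq_preimage_fst` (a fibre of
  `pr₁ ∘ Φ`), not as a separate fact: it follows from transitivity since `{1} × Sⁿ` is a fibre of
  the product bundle; smooth fibre bundles with structure group `Diff(Sⁿ)` are not otherwise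
  available.
* Not here: Thm. 3.12 (reducing balls in `S¹ × Bⁿ`), the isotopy-level statements of §3
  (`π₀ Diff₀(S¹ × Sⁿ)`, Lemma 3.14 ff.).

## References

* R. Budney, D. Gabai, *Knotted 3-balls in `S⁴`*, arXiv:1912.09029 (v2), §3: Thm. 3.12,
  Thm. 3.13 (p. 22). [BudneyGabai2019]
* J. Cerf, *Topologie de certains espaces de plongements*, Bull. SMF 89 (1961); R. Palais,
  *Extending diffeomorphisms*, Proc. AMS 11 (1960) (the disc theorem quoted in the proof).
-/

noncomputable section

open scoped Manifold ContDiff Topology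
open Set Function

namespace Literature.Topology.FourManifolds

/-! ### The standard non-separating sphere `{1} × Sⁿ ⊂ S¹ × Sⁿ` -/

section Standard

variable (n : ℕ)

/-- The **standard `n`-sphere `{1} × Sⁿ`** in `S¹ × Sⁿ`, as the map `p ↦ (1, p)`
(Budney–Gabai 2019, §3: the model non-separating sphere / the fibre `{1} × Sⁿ`). [folklore] -/
def standardSphere : Metric.sphere (0 : EuclideanSpace ℝ (Fin (n + 1))) 1 →
    Circle × Metric.sphere (0 : EuclideanSpace ℝ (Fin (n + 1))) 1 :=
  fun p ↦ ((1 : Circle), p)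

/-- Unfolding lemma for `standardSphere`. [folklore] -/
@[simp] theorem standardSphere_apply (p : Metric.sphere (0 : EuclideanSpace ℝ (Fin (n + 1))) 1) :
    standardSphere n p = ((1 : Circle), p) :=
  rfl

/-- The image of the standard sphere is `{1} × Sⁿ`. [folklore] -/
theorem range_standardSphere :
    range (standardSphere n) = ({1} : Set Circle) ×ˢ (univ : Set (Metric.sphere
      (0 : EuclideanSpace ℝ (Fin (n + 1))) 1)) := by
  ext ⟨z, p⟩
  simp only [mem_range, standardSphere_apply, Prod.mk.injEq, mem_prod, mem_singleton_iff, mem_univ,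
    and_true]
  exact ⟨fun ⟨q, hq⟩ ↦ hq.1.symm, fun hz ↦ ⟨p, hz.symm, rfl⟩⟩

/-- The complement of the standard sphere is `(S¹ ∖ {1}) × Sⁿ`. [folklore] -/
theorem compl_range_standardSphere :
    (range (standardSphere n))ᶜ = ({1}ᶜ : Set Circle) ×ˢ (univ : Set (Metric.sphere
      (0 : EuclideanSpace ℝ (Fin (n + 1))) 1)) := by
  rw [range_standardSphere]
  ext ⟨z, p⟩
  simp

/-- **The standard sphere `{1} × Sⁿ` is non-separating** for `n ≥ 1`: its complement
`(S¹ ∖ {1}) × Sⁿ` is connected (a punctured circle is an arc; `Sⁿ` is connected for `n ≥ 1`).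
[folklore] -/
theorem isConnected_compl_range_standardSphere (hn : 1 ≤ n) :
    IsConnected (range (standardSphere n))ᶜ := by
  rw [compl_range_standardSphere]
  have h1 : IsPathConnected ({1}ᶜ : Set Circle) := Circle.isPathConnected_compl_singleton 1
  have h2 : IsPathConnected
      (univ : Set (Metric.sphere (0 : EuclideanSpace ℝ (Fin (n + 1))) 1)) := by
    have hr : 1 < Module.rank ℝ (EuclideanSpace ℝ (Fin (n + 1))) :=
      Module.lt_rank_of_lt_finrank (by rw [finrank_euclideanSpace_fin]; omega)
    haveI := isPathConnected_iff_pathConnectedSpace.mp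
      (isPathConnected_sphere hr (0 : EuclideanSpace ℝ (Fin (n + 1))) zero_le_one)
    exact isPathConnected_univ
  exact (h1.prod h2).isConnected

/-- **The standard sphere `p ↦ (1, p)` is a smooth embedding `Sⁿ → S¹ × Sⁿ`**: it is smooth
(a constant paired with the identity) and injective with injective differential `v ↦ (0, v)`, on a
compact manifold, so the tree's criterion `isSmoothEmbedding_of_injective_of_injective_mfderiv`
(Hirsch, Ch. 1 §3, Thm. 3.1) applies. [folklore] -/
theorem isSmoothEmbedding_standardSphere :
    Manifold.IsSmoothEmbedding (𝓡 n) ((𝓡 1).prod (𝓡 n)) ∞ (standardSphere n) := by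
  have hsmooth : ContMDiff (𝓡 n) ((𝓡 1).prod (𝓡 n)) ∞ (standardSphere n) :=
    contMDiff_const.prodMk contMDiff_id
  refine isSmoothEmbedding_of_injective_of_injective_mfderiv hsmooth (by simp)
    (fun p q h ↦ by simpa using congrArg Prod.snd h) fun p ↦ ?_
  have hd : mfderiv (𝓡 n) ((𝓡 1).prod (𝓡 n)) (standardSphere n) p =
      (mfderiv (𝓡 n) (𝓡 1) (fun _ : Metric.sphere (0 : EuclideanSpace ℝ (Fin (n + 1))) 1 ↦
          (1 : Circle)) p).prod
        (mfderiv (𝓡 n) (𝓡 n) (id : Metric.sphere (0 : EuclideanSpace ℝ (Fin (n + 1))) 1 →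
          Metric.sphere (0 : EuclideanSpace ℝ (Fin (n + 1))) 1) p) :=
    mfderiv_prodMk mdifferentiableAt_const mdifferentiableAt_id
  rw [hd, mfderiv_const, mfderiv_id]
  intro v w hvw
  exact congrArg Prod.snd hvw

end Standard

/-! ### Budney–Gabai 2019, Theorem 3.13 -/

section Fact

/-- **Budney–Gabai 2019, Theorem 3.13 (first sentence): `Diff(S¹ × Sⁿ)` acts transitively on
the non-separating `n`-spheres in `S¹ × Sⁿ`.** For every `n` and any two smooth embeddings
`e₁, e₂ : Sⁿ → S¹ × Sⁿ` (`Sⁿ ⊂ ℝⁿ⁺¹` the unit sphere, `S¹` = `Circle`, Mathlib manifold structures,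
`C^∞`) whose images have connected complement, there is a diffeomorphism `Φ` of `S¹ × Sⁿ` with
`Φ(e₁(Sⁿ)) = e₂(Sⁿ)`. Printed: *"The group `Diff(S¹ × Sⁿ)` acts transitively on the non-separating
`n`-spheres in `S¹ × Sⁿ`. Moreover, every non-separating `n`-sphere is the fiber of a fiber bundle
`S¹ × Sⁿ → S¹`."* (the "moreover" is the corollary
`BudneyGabai2019_thm_3_13.exists_eq_preimage_fst`;
the case `n < 3` is classical, `n ≥ 3` is theirs, via Thm. 3.12 and the Cerf–Palais disc theorem).
[cite: BudneyGabai2019, Thm. 3.13 (arXiv:1912.09029 v2, p. 22)] -/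
def BudneyGabai2019_thm_3_13 : Prop :=
  ∀ (n : ℕ)
    (e₁ e₂ : Metric.sphere (0 : EuclideanSpace ℝ (Fin (n + 1))) 1 →
      Circle × Metric.sphere (0 : EuclideanSpace ℝ (Fin (n + 1))) 1),
    Manifold.IsSmoothEmbedding (𝓡 n) ((𝓡 1).prod (𝓡 n)) ∞ e₁ → IsConnected (range e₁)ᶜ →
    Manifold.IsSmoothEmbedding (𝓡 n) ((𝓡 1).prod (𝓡 n)) ∞ e₂ → IsConnected (range e₂)ᶜ →
      ∃ Φ : (Circle × Metric.sphere (0 : EuclideanSpace ℝ (Fin (n + 1))) 1) ≃ₘ⟮(𝓡 1).prod (𝓡 n),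
          (𝓡 1).prod (𝓡 n)⟯ (Circle × Metric.sphere (0 : EuclideanSpace ℝ (Fin (n + 1))) 1),
        Φ '' range e₁ = range e₂

namespace BudneyGabai2019_thm_3_13

variable (h : BudneyGabai2019_thm_3_13)

include h

/-- Under Thm. 3.13: **every non-separating `n`-sphere in `S¹ × Sⁿ` (`n ≥ 1`) is carried onto the
standard one `{1} × Sⁿ` by a diffeomorphism** (transitivity applied to `e₂ = standardSphere n`,
which is a non-separating smooth sphere by `isSmoothEmbedding_standardSphere`,
`isConnected_compl_range_standardSphere`). [cite: BudneyGabai2019, Thm. 3.13] -/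
theorem exists_image_eq_range_standardSphere {n : ℕ} (hn : 1 ≤ n)
    (e : Metric.sphere (0 : EuclideanSpace ℝ (Fin (n + 1))) 1 →
      Circle × Metric.sphere (0 : EuclideanSpace ℝ (Fin (n + 1))) 1)
    (he : Manifold.IsSmoothEmbedding (𝓡 n) ((𝓡 1).prod (𝓡 n)) ∞ e)
    (hconn : IsConnected (range e)ᶜ) :
    ∃ Φ : (Circle × Metric.sphere (0 : EuclideanSpace ℝ (Fin (n + 1))) 1) ≃ₘ⟮(𝓡 1).prod (𝓡 n),
        (𝓡 1).prod (𝓡 n)⟯ (Circle × Metric.sphere (0 : EuclideanSpace ℝ (Fin (n + 1))) 1),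
      Φ '' range e = range (standardSphere n) :=
  h n e (standardSphere n) he hconn (isSmoothEmbedding_standardSphere n)
    (isConnected_compl_range_standardSphere n hn)

/-- Under Thm. 3.13, **the case `n = 3`** in the shape of the route item `NonSepSphereTransitive`
(`SmoothPoincare4/CircularKirby`): a smoothly embedded non-separating `3`-sphere in `S¹ × S³` is
carried onto `{1} × S³` by a diffeomorphism of `S¹ × S³`. [cite: BudneyGabai2019, Thm. 3.13] -/
theorem exists_image_eq_range_standardSphere_three
    (e : Metric.sphere (0 : EuclideanSpace ℝ (Fin 4)) 1 →
      Circle × Metric.sphere (0 : EuclideanSpace ℝ (Fin 4)) 1)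
    (he : Manifold.IsSmoothEmbedding (𝓡 3) ((𝓡 1).prod (𝓡 3)) ∞ e)
    (hconn : IsConnected (range e)ᶜ) :
    ∃ Φ : (Circle × Metric.sphere (0 : EuclideanSpace ℝ (Fin 4)) 1) ≃ₘ⟮(𝓡 1).prod (𝓡 3),
        (𝓡 1).prod (𝓡 3)⟯ (Circle × Metric.sphere (0 : EuclideanSpace ℝ (Fin 4)) 1),
      Φ '' range e = range fun p ↦ ((1 : Circle), p) :=
  h.exists_image_eq_range_standardSphere (n := 3) (by norm_num) e he hconn

/-- Under Thm. 3.13, the **"moreover"**: every non-separating `n`-sphere (`n ≥ 1`) is a fibre of a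
smooth fibre bundle `S¹ × Sⁿ → S¹` — indeed of the trivial one `pr₁ ∘ Φ` for the diffeomorphism
`Φ` carrying it onto `{1} × Sⁿ`: `e(Sⁿ) = (pr₁ ∘ Φ)⁻¹(1)`. [cite: BudneyGabai2019, Thm. 3.13] -/
theorem exists_eq_preimage_fst {n : ℕ} (hn : 1 ≤ n)
    (e : Metric.sphere (0 : EuclideanSpace ℝ (Fin (n + 1))) 1 →
      Circle × Metric.sphere (0 : EuclideanSpace ℝ (Fin (n + 1))) 1)
    (he : Manifold.IsSmoothEmbedding (𝓡 n) ((𝓡 1).prod (𝓡 n)) ∞ e)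
    (hconn : IsConnected (range e)ᶜ) :
    ∃ Φ : (Circle × Metric.sphere (0 : EuclideanSpace ℝ (Fin (n + 1))) 1) ≃ₘ⟮(𝓡 1).prod (𝓡 n),
        (𝓡 1).prod (𝓡 n)⟯ (Circle × Metric.sphere (0 : EuclideanSpace ℝ (Fin (n + 1))) 1),
      range e = (Prod.fst ∘ Φ) ⁻¹' {1} := by
  obtain ⟨Φ, hΦ⟩ := h.exists_image_eq_range_standardSphere hn e he hconn
  refine ⟨Φ, ?_⟩
  have hinj : Function.Injective Φ := Φ.injective
  rw [← hinj.preimage_image (range e), hΦ, range_standardSphere]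
  ext x
  simp

end BudneyGabai2019_thm_3_13

end Fact

end Literature.Topology.FourManifolds

end
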